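/-
Copyright (c) 2026 the pub-hodgecm-mathlib formalisation cell (harness21).  Prover seat hodgecm-mathlib-K2E5-p16 (g4): Track B «K2-LIT»,
hLiu418 = stmt-HodgeConjecture-24832, LEAD F0P6-plan (g11) LAST DEALS 2026-09-04T05:45:00Z (1) «Φ6b-0 TUBE» (in force under LEAD (g12)) =
ROAD Φ organ Φ6b-0, FIBRES file: branch facts and the complex-parameter fibres of the Siegel–Gindikin integral at a tube argument; 2026-09-04.
-/
import Summits.HodgeConjecture.HodgeConjecture.Theorems.K2LiuHermTwoGammaDefs              -- ★ p857639: `hermTwoGamma`, `hermTwo` + API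
import Summits.HodgeConjecture.HodgeConjecture.Theorems.K2LiuHermTwoSiegelGindikinFibres     -- ★ p857667: `integral_Ioi_comp_add`, fibres at `y > 0`
import Literature.Analysis.SpecialFunctions.CauchyBetaIntegral                               -- ★ `one_div_cpow_eq_cpow_neg` (+ ★ complex-`r` Gamma integral)
import Literature.Dynamics.TransferOperators.ZagierPsi                                       -- ★ `mul_cpow_of_re_pos`
import HarnessLib

/-!
# Crux `HLiu418`, ROAD Φ, organ Φ6b-0 «TUBE» — FIBRES: branch facts on the tube `Y + Yᴴ > 0` and the complex-parameter fibres
# of `1_{x>0} e^{−tr(x Y)} (det x)^{s−2}` in the chart `x = [[a, z],[z̄, b]]`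

Cell `hodgecm-mathlib`, crux item hLiu418 = `stmt-HodgeConjecture-24832`, route of record `HCCMUnconditional`; squad K2, LEAD F0P6-plan (g11 → g12)
(LAST DEALS 05:45:00Z (1) «Φ6b-0 TUBE»), dealer K2E5-plan (g5) (CENSUS-41 row Φ6), prover K2E5-p16 (g4).  THEOREMS ONLY (no `def`, no instance,
no notation, no named-fact hypothesis, no `sorry`, default heartbeats); lane `--supports stmt-HodgeConjecture-24832 --as helper` (count-neutral).

WHAT IS PROVED.
* PRINCIPAL POWERS IN THE RIGHT HALF-PLANE are ★ in the tree: `Literature.Dynamics.TransferOperators.mul_cpow_of_re_pos`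
  (`(z₁z₂)^w = z₁^w z₂^w` for `re zᵢ > 0`), `Literature.Analysis.SpecialFunctions.one_div_cpow_eq_cpow_neg` (`(1/z)^w = z^{−w}`) — imported.
* THE TUBE IN COORDINATES `Y = [[P, W₁],[W₂, Q]]`, hypothesis `(Y + Yᴴ).PosDef`: `trace_hermTwo_mul` (`tr(xY) = aP + zW₂ + z̄W₁ + bQ`),
  `add_conjTranspose_eq_hermTwo` (`Y + Yᴴ = hermTwo (2 re P, W₁ + W̄₂, 2 re Q)`), `re_apply_zero_zero∕one_one_pos_of_tube`,
  `normSq_hermPart_lt_of_tube` (`|(W₁ + W̄₂)/2|² < re P · re Q`), the SCHUR COMPLEMENT `re_conj_mul_det_pos_of_tube` (`re(Q̄ · det Y) > 0`, from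
  `v*(Y + Yᴴ)v = 2 re(Q̄ det Y)` at `v = (Q, −W₂)`), `det_ne_zero_of_tube`, `re_det_div_pos_of_tube` (`re(det Y / Q) > 0`) and THE BRANCH
  `det_cpow_eq_of_tube : (det Y)^w = Q^w (det Y/Q)^w` — `det Y ∉ (−∞, 0]` on the tube and the principal power is the continuous branch.
* THE FIBRES with complex parameters (section variables `fY`, `D` with defining equations `hfY`, `hD`; `re Q > 0`, `a > 0`, `1 < re s`):
  `measurable_indicator_tube`; LEVEL 1 `integral_tube_fibre_b` (+ `_ne_zero`) by the complex-`r` Gamma integral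
  ★ `Literature.NumberTheory.LFunctions.AFE.integral_cpow_mul_exp_neg_mul_Ioi_complex`: `e^{−(aP + zW₂ + z̄W₁ + Q|z|²/a)} a^{s−2} Q^{1−s} Γ(s−1)`;
  LEVEL 2 `integral_cexp_neg_mul_normSq_sub_linear` (`∫_ℂ e^{−β|z|² − (zW₂ + z̄W₁)} dz = (π/β) e^{W₁W₂/β}`, `re β > 0`: ★ `Complex.volume_preserving_equiv_pi`
  + ★ `GaussianFourier.integral_cexp_neg_mul_sum_add` on `Fin 2 → ℝ` with `c = (−(W₁+W₂), I(W₁−W₂))`, `Σcᵢ² = 4W₁W₂`) and `integral_tube_fibre_z`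
  (+ `_ne_zero`): `π Γ(s−1) Q^{−s} a^{s−1} e^{−(P − W₁W₂/Q)a}`; LEVEL 3 `integral_tube_fibre_a` (`re(P − W₁W₂/Q) > 0`):
  `Γ₂(s) Q^{−s}(P − W₁W₂/Q)^{−s} = Γ₂(s)(PQ − W₁W₂)^{−s}`.
The integrability (dominated by ★ Φ6a), the assembly and the matrix-form heads are the file `K2LiuHermTwoSiegelGindikinTube.lean`.

HONEST LABEL.  Count-neutral helper of the K2_Liu road; it pays no socket by itself: `HC_CM` is proved only modulo the 7 printed citations
(2 remaining named inputs: hLiu418 = `stmt-HodgeConjecture-24832`, h413 = `stmt-HodgeConjecture-24833`) until rung 0 closes.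
References (orientation only): [Shimura1982] §1 (1.16) Case II; Faraut–Korányi Thm. VII.1.1, Prop. VII.1.2.
-/

set_option autoImplicit false
-- the mandated namespace repeats the single-problem summit's segment (`HodgeConjecture.HodgeConjecture`)
set_option linter.dupNamespace false

noncomputable section

open Complex MeasureTheory Set
open scoped ComplexOrder ComplexConjugate

namespace Summit.HodgeConjecture.HodgeConjecture.Cruxes.HLiu418.K2LiuHermTwoSiegelGindikinTubeFibres

open Summit.HodgeConjecture.HodgeConjecture.Cruxes.HLiu418.K2LiuHermTwoGammaDefs
open Summit.HodgeConjecture.HodgeConjecture.Cruxes.HLiu418.K2LiuHermTwoSiegelGindikinFibres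

/-! ## Principal powers in the right half-plane

`(z₁ z₂)^w = z₁^w z₂^w` and `(1/z)^w = z^{−w}` for `re zᵢ > 0` are ★ `Literature.Dynamics.TransferOperators.mul_cpow_of_re_pos` and
★ `Literature.Analysis.SpecialFunctions.one_div_cpow_eq_cpow_neg` (imported, not restated). -/

/-! ## The trace form and the branch facts on the tube -/

/-- `tr ([[a, z],[z̄, b]] · Y) = a·Y₀₀ + z·Y₁₀ + z̄·Y₀₁ + b·Y₁₁`. -/
theorem trace_hermTwo_mul (c : ℝ × ℂ × ℝ) (Y : Matrix (Fin 2) (Fin 2) ℂ) :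
    (hermTwo c * Y).trace = (c.1 : ℂ) * Y 0 0 + c.2.1 * Y 1 0 + conj c.2.1 * Y 0 1 + (c.2.2 : ℂ) * Y 1 1 := by
  rw [Matrix.trace_fin_two, Matrix.mul_apply, Matrix.mul_apply, Fin.sum_univ_two, Fin.sum_univ_two]
  simp only [hermTwo_apply_zero_zero, hermTwo_apply_zero_one, hermTwo_apply_one_zero, hermTwo_apply_one_one]
  ring

/-- The Hermitian part in the chart: `Y + Yᴴ = hermTwo (2 re Y₀₀, Y₀₁ + conj Y₁₀, 2 re Y₁₁)`. -/
theorem add_conjTranspose_eq_hermTwo (Y : Matrix (Fin 2) (Fin 2) ℂ) :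
    Y + Y.conjTranspose = hermTwo (2 * (Y 0 0).re, Y 0 1 + conj (Y 1 0), 2 * (Y 1 1).re) := by
  ext i j
  fin_cases i <;> fin_cases j
  · simp [Matrix.conjTranspose_apply, Complex.add_conj]
  · simp [Matrix.conjTranspose_apply]
  · simp [Matrix.conjTranspose_apply, map_add, add_comm]
  · simp [Matrix.conjTranspose_apply, Complex.add_conj]

/-- On the tube `re Y₁₁ > 0` (test vector `(0, 1)`). -/
theorem re_apply_one_one_pos_of_tube {Y : Matrix (Fin 2) (Fin 2) ℂ} (hY : (Y + Y.conjTranspose).PosDef) : 0 < (Y 1 1).re := by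
  rw [add_conjTranspose_eq_hermTwo] at hY
  have h := (posDef_hermTwo_iff _).mp hY
  have h1 : 0 < 2 * (Y 0 0).re := h.1
  have h2 : normSq (Y 0 1 + conj (Y 1 0)) < 2 * (Y 0 0).re * (2 * (Y 1 1).re) := h.2
  nlinarith [normSq_nonneg (Y 0 1 + conj (Y 1 0))]

/-- On the tube `re Y₀₀ > 0` (test vector `(1, 0)`). -/
theorem re_apply_zero_zero_pos_of_tube {Y : Matrix (Fin 2) (Fin 2) ℂ} (hY : (Y + Y.conjTranspose).PosDef) : 0 < (Y 0 0).re := by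
  rw [add_conjTranspose_eq_hermTwo] at hY
  have h := (posDef_hermTwo_iff _).mp hY
  have h1 : 0 < 2 * (Y 0 0).re := h.1
  linarith

/-- On the tube the data of the Hermitian part `H = [[re Y₀₀, (Y₀₁ + conj Y₁₀)/2],[·, re Y₁₁]]` lie in the cone: `|(Y₀₁ + conj Y₁₀)/2|² < re Y₀₀ · re Y₁₁`. -/
theorem normSq_hermPart_lt_of_tube {Y : Matrix (Fin 2) (Fin 2) ℂ} (hY : (Y + Y.conjTranspose).PosDef) :
    normSq ((Y 0 1 + conj (Y 1 0)) / 2) < (Y 0 0).re * (Y 1 1).re := by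
  rw [add_conjTranspose_eq_hermTwo] at hY
  have h := (posDef_hermTwo_iff _).mp hY
  have h2 : normSq (Y 0 1 + conj (Y 1 0)) < 2 * (Y 0 0).re * (2 * (Y 1 1).re) := h.2
  rw [map_div₀, show normSq (2 : ℂ) = 4 by norm_num [normSq_apply]]
  linarith

/-- SCHUR COMPLEMENT ON THE TUBE: `re (conj Y₁₁ · det Y) > 0`, i.e. `re (v* Y v) > 0` for `v = (Y₁₁, −Y₁₀)` (for which `Y v = (det Y, 0)`),
from `2 re (v* Y v) = v* (Y + Yᴴ) v > 0`. -/
theorem re_conj_mul_det_pos_of_tube {Y : Matrix (Fin 2) (Fin 2) ℂ} (hY : (Y + Y.conjTranspose).PosDef) :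
    0 < (conj (Y 1 1) * Y.det).re := by
  have hQ : 0 < (Y 1 1).re := re_apply_one_one_pos_of_tube hY
  have hv : (![Y 1 1, -Y 1 0] : Fin 2 → ℂ) ≠ 0 := by
    intro h
    have h0 := congr_fun h 0
    simp only [Matrix.cons_val_zero, Pi.zero_apply] at h0
    rw [h0] at hQ
    simp at hQ
  have hpos := hY.dotProduct_mulVec_pos hv
  rw [add_conjTranspose_eq_hermTwo, star_dotProduct_hermTwo_mulVec, Complex.zero_lt_real] at hpos
  simp only [Matrix.cons_val_zero, Matrix.cons_val_one] at hpos
  rw [Matrix.det_fin_two]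
  have key : (2 * (Y 0 0).re) * normSq (Y 1 1) + (2 * (Y 1 1).re) * normSq (-Y 1 0) +
        2 * (conj (Y 1 1) * (Y 0 1 + conj (Y 1 0)) * (-Y 1 0)).re
      = 2 * (conj (Y 1 1) * (Y 0 0 * Y 1 1 - Y 0 1 * Y 1 0)).re := by
    simp only [normSq_apply, Complex.mul_re, Complex.mul_im, Complex.add_re, Complex.add_im, Complex.sub_re,
      Complex.sub_im, Complex.neg_re, Complex.neg_im, Complex.conj_re, Complex.conj_im]
    ring
  -- `hpos` is `0 < 2·re(Y₀₀)·|Y₁₁|² + 2·re(Y₁₁)·|−Y₁₀|² + 2·re(conj Y₁₁ · (Y₀₁ + conj Y₁₀) · (−Y₁₀))`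
  have hpos' : 0 < 2 * (conj (Y 1 1) * (Y 0 0 * Y 1 1 - Y 0 1 * Y 1 0)).re := by
    rw [← key]
    simpa [Matrix.cons_val_one, Matrix.head_cons] using hpos
  linarith

/-- On the tube `det Y ≠ 0`. -/
theorem det_ne_zero_of_tube {Y : Matrix (Fin 2) (Fin 2) ℂ} (hY : (Y + Y.conjTranspose).PosDef) : Y.det ≠ 0 := by
  intro h
  have := re_conj_mul_det_pos_of_tube hY
  rw [h, mul_zero, Complex.zero_re] at this
  exact lt_irrefl _ this

/-- On the tube the Schur complement `det Y / Y₁₁` has positive real part. -/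
theorem re_det_div_pos_of_tube {Y : Matrix (Fin 2) (Fin 2) ℂ} (hY : (Y + Y.conjTranspose).PosDef) :
    0 < (Y.det / Y 1 1).re := by
  have hQ : 0 < (Y 1 1).re := re_apply_one_one_pos_of_tube hY
  have hQ0 : Y 1 1 ≠ 0 := fun h => by simp [h] at hQ
  have hn : 0 < normSq (Y 1 1) := normSq_pos.mpr hQ0
  have h := re_conj_mul_det_pos_of_tube hY
  have hdiv : Y.det / Y 1 1 = conj (Y 1 1) * Y.det * ((normSq (Y 1 1))⁻¹ : ℝ) := by
    rw [div_eq_mul_inv, Complex.inv_def]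
    push_cast
    ring
  rw [hdiv, Complex.mul_re, ofReal_re, ofReal_im, mul_zero, sub_zero]
  exact mul_pos h (inv_pos.mpr hn)

/-- THE BRANCH on the tube: `(det Y)^w = (Y₁₁)^w · (det Y / Y₁₁)^w` (principal powers), both factors having positive real part;
in particular `det Y ∉ (−∞, 0]`. -/
theorem det_cpow_eq_of_tube {Y : Matrix (Fin 2) (Fin 2) ℂ} (hY : (Y + Y.conjTranspose).PosDef) (w : ℂ) :
    Y.det ^ w = (Y 1 1) ^ w * (Y.det / Y 1 1) ^ w := by
  have hQ : 0 < (Y 1 1).re := re_apply_one_one_pos_of_tube hY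
  have hQ0 : Y 1 1 ≠ 0 := fun h => by simp [h] at hQ
  rw [← Literature.Dynamics.TransferOperators.mul_cpow_of_re_pos hQ (re_det_div_pos_of_tube hY), mul_div_cancel₀ _ hQ0]

/-! ## The computation in coordinates (complex parameters)

`Y = [[P, W₁],[W₂, Q]]` enters through implicit `P Q W₁ W₂ : ℂ`; the integrand `fY s (a, z, b) = e^{−(aP + zW₂ + z̄W₁ + bQ)} (ab − |z|²)^{s−2}`
and the cone `D` are section variables with defining equations (no auxiliary `def`). -/

section Coordinates

variable {P Q W₁ W₂ : ℂ}
variable (fY : ℂ → ℝ × ℂ × ℝ → ℂ)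
  (hfY : ∀ (s : ℂ) (c : ℝ × ℂ × ℝ), fY s c =
    cexp (-((c.1 : ℂ) * P + c.2.1 * W₂ + conj c.2.1 * W₁ + (c.2.2 : ℂ) * Q)) *
      ((c.1 * c.2.2 - normSq c.2.1 : ℝ) : ℂ) ^ (s - 2))
variable (D : Set (ℝ × ℂ × ℝ)) (hD : D = {c | 0 < c.1 ∧ normSq c.2.1 < c.1 * c.2.2})

include hfY hD in
/-- Measurability of the truncated tube integrand. -/
theorem measurable_indicator_tube (s : ℂ) : Measurable (D.indicator (fY s)) := by
  have hfs : fY s = fun c : ℝ × ℂ × ℝ =>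
      cexp (-((c.1 : ℂ) * P + c.2.1 * W₂ + conj c.2.1 * W₁ + (c.2.2 : ℂ) * Q)) *
        ((c.1 * c.2.2 - normSq c.2.1 : ℝ) : ℂ) ^ (s - 2) := funext (hfY s)
  have hDm : MeasurableSet D := by
    rw [hD, setOf_and]
    exact (measurableSet_lt measurable_const measurable_fst).inter
      (measurableSet_lt (Complex.continuous_normSq.measurable.comp measurable_snd.fst)
        (measurable_fst.mul measurable_snd.snd))
  rw [hfs]
  refine Measurable.indicator (Measurable.mul ?_ ?_) hDm
  · have hc : Continuous fun c : ℝ × ℂ × ℝ =>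
        -((c.1 : ℂ) * P + c.2.1 * W₂ + conj c.2.1 * W₁ + (c.2.2 : ℂ) * Q) := by fun_prop
    exact Complex.measurable_exp.comp hc.measurable
  · have hc : Continuous fun c : ℝ × ℂ × ℝ => c.1 * c.2.2 - normSq c.2.1 := by fun_prop
    exact (Complex.measurable_ofReal.comp hc.measurable).pow_const _

/-! ### Level 1: the fibre in `b` (complex-`r` Gamma integral, `re Q > 0`) -/

include hfY hD in
/-- The `b`-fibre of the truncated tube integrand (`a > 0`, `z` fixed, `re Q > 0`): after the shift `b = |z|²/a + t`,
`∫ db = e^{−(aP + zW₂ + z̄W₁ + Q|z|²/a)} · a^{s−2} · Q^{1−s} Γ(s−1)`. -/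
theorem integral_tube_fibre_b (hQ : 0 < Q.re) {s : ℂ} (hs : 1 < s.re) {a : ℝ} (ha : 0 < a) (z : ℂ) :
    ∫ b : ℝ, D.indicator (fY s) (a, z, b) =
      cexp (-((a : ℂ) * P + z * W₂ + conj z * W₁ + ((normSq z / a : ℝ) : ℂ) * Q)) * (a : ℂ) ^ (s - 2) *
        ((1 / Q) ^ (s - 1) * Complex.Gamma (s - 1)) := by
  have h1 : (fun b : ℝ => D.indicator (fY s) (a, z, b)) =
      (Ioi (normSq z / a)).indicator (fun b => fY s (a, z, b)) := by
    funext b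
    by_cases hb : normSq z / a < b
    · have hmem : (a, z, b) ∈ D := by
        rw [hD]
        exact ⟨ha, by rw [mul_comm]; exact (div_lt_iff₀ ha).mp hb⟩
      rw [indicator_of_mem hmem, indicator_of_mem (show b ∈ Ioi _ from hb)]
    · have hnmem : (a, z, b) ∉ D := by
        rw [hD]
        rintro ⟨-, h⟩
        exact hb ((div_lt_iff₀ ha).mpr (by rw [mul_comm]; exact h))
      rw [indicator_of_notMem hnmem, indicator_of_notMem (show b ∉ Ioi _ from hb)]
  rw [h1, integral_indicator measurableSet_Ioi, ← integral_Ioi_comp_add]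
  have h2 : EqOn (fun t : ℝ => fY s (a, z, t + normSq z / a))
      (fun t : ℝ => cexp (-((a : ℂ) * P + z * W₂ + conj z * W₁ + ((normSq z / a : ℝ) : ℂ) * Q)) * (a : ℂ) ^ (s - 2) *
        ((t : ℂ) ^ (s - 1 - 1) * cexp (-(Q * t)))) (Ioi 0) := by
    intro t ht
    have ht' : 0 ≤ t := le_of_lt ht
    simp only [hfY]
    have hdet : a * (t + normSq z / a) - normSq z = a * t := by
      field_simp
      ring
    have htr : ((a : ℂ) * P + z * W₂ + conj z * W₁ + ((t + normSq z / a : ℝ) : ℂ) * Q) =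
        ((a : ℂ) * P + z * W₂ + conj z * W₁ + ((normSq z / a : ℝ) : ℂ) * Q) + Q * (t : ℂ) := by
      push_cast
      ring
    rw [hdet, htr, neg_add, Complex.exp_add, show s - 1 - 1 = s - 2 by ring, Complex.ofReal_mul,
      mul_cpow_ofReal_nonneg ha.le ht']
    ring
  rw [setIntegral_congr_fun measurableSet_Ioi h2, integral_const_mul,
    Literature.NumberTheory.LFunctions.AFE.integral_cpow_mul_exp_neg_mul_Ioi_complex
      (by simp only [sub_re, one_re]; linarith) hQ]

/-- The closed form of the `b`-fibre is nonzero. -/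
theorem tube_fibre_b_ne_zero (hQ : 0 < Q.re) {s : ℂ} (hs : 1 < s.re) {a : ℝ} (ha : 0 < a) (z : ℂ) :
    cexp (-((a : ℂ) * P + z * W₂ + conj z * W₁ + ((normSq z / a : ℝ) : ℂ) * Q)) * (a : ℂ) ^ (s - 2) *
        ((1 / Q) ^ (s - 1) * Complex.Gamma (s - 1)) ≠ 0 := by
  have hQ0 : Q ≠ 0 := fun h => by simp [h] at hQ
  have h1 : (a : ℂ) ^ (s - 2) ≠ 0 := by
    rw [Ne, cpow_eq_zero_iff, not_and_or]
    exact Or.inl (ofReal_ne_zero.mpr ha.ne')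
  have h2 : (1 / Q) ^ (s - 1) ≠ 0 := by
    rw [Ne, cpow_eq_zero_iff, not_and_or]
    exact Or.inl (one_div_ne_zero hQ0)
  have h3 : Complex.Gamma (s - 1) ≠ 0 :=
    Complex.Gamma_ne_zero_of_re_pos (by simp only [sub_re, one_re]; linarith)
  exact mul_ne_zero (mul_ne_zero (Complex.exp_ne_zero _) h1) (mul_ne_zero h2 h3)

/-! ### Level 2: the fibre in `z` (Gaussian on `ℂ ≅ ℝ²` with a general complex linear term) -/

/-- The Gaussian with a general complex linear term over `ℂ ≅ ℝ²`: for `re β > 0`,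
`∫_ℂ e^{−β|z|² − (zW₂ + z̄W₁)} dz = (π/β) e^{W₁W₂/β}`. -/
theorem integral_cexp_neg_mul_normSq_sub_linear {β : ℂ} (hβ : 0 < β.re) (W₁ W₂ : ℂ) :
    ∫ z : ℂ, cexp (-(β * (normSq z : ℂ) + (z * W₂ + conj z * W₁))) = (Real.pi : ℂ) / β * cexp (W₁ * W₂ / β) := by
  have hβ0 : β ≠ 0 := fun h => by simp [h] at hβ
  have hmp : MeasurePreserving (⇑Complex.measurableEquivPi.symm) volume volume :=
    Complex.volume_preserving_equiv_pi.symm _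
  rw [← hmp.integral_comp']
  have key := GaussianFourier.integral_cexp_neg_mul_sum_add (ι := Fin 2) hβ ![-(W₁ + W₂), I * (W₁ - W₂)]
  simp only [Fin.sum_univ_two, Matrix.cons_val_zero, Matrix.cons_val_one, Fintype.card_fin] at key
  have hpt : ∀ v : Fin 2 → ℝ,
      cexp (-(β * (normSq (Complex.measurableEquivPi.symm v) : ℂ) +
          (Complex.measurableEquivPi.symm v * W₂ + conj (Complex.measurableEquivPi.symm v) * W₁))) =
        cexp (-β * ((v 0 : ℂ) ^ 2 + (v 1 : ℂ) ^ 2) + (-(W₁ + W₂) * (v 0 : ℂ) + I * (W₁ - W₂) * (v 1 : ℂ))) := by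
    intro v
    congr 1
    rw [Complex.measurableEquivPi_symm_apply, normSq_apply, map_add, map_mul, conj_ofReal, conj_ofReal, conj_I]
    simp only [add_re, add_im, mul_re, mul_im, ofReal_re, ofReal_im, I_re, I_im, mul_zero, mul_one, zero_add,
      add_zero, sub_zero]
    push_cast
    ring
  simp_rw [hpt]
  rw [key]
  have h22 : ((2 : ℕ) : ℂ) / 2 = 1 := by norm_num
  rw [h22, cpow_one]
  congr 1
  · congr 1
    rw [mul_pow, I_sq]
    field_simp
    ring

/-- Integrating the closed form of the `b`-fibre over `z ∈ ℂ`: `π Γ(s−1) Q^{−s} · a^{s−1} e^{−(P − W₁W₂/Q) a}` (we keep `(1/Q)^{s−1}·(1/Q)`). -/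
theorem integral_tube_fibre_z (hQ : 0 < Q.re) (s : ℂ) {a : ℝ} (ha : 0 < a) :
    ∫ z : ℂ, cexp (-((a : ℂ) * P + z * W₂ + conj z * W₁ + ((normSq z / a : ℝ) : ℂ) * Q)) * (a : ℂ) ^ (s - 2) *
        ((1 / Q) ^ (s - 1) * Complex.Gamma (s - 1)) =
      (Real.pi : ℂ) * Complex.Gamma (s - 1) * (1 / Q) ^ (s - 1) * (1 / Q) *
        ((a : ℂ) ^ (s - 1) * cexp (-((P - W₁ * W₂ / Q) * a))) := by
  have ha0 : (a : ℂ) ≠ 0 := ofReal_ne_zero.mpr ha.ne'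
  have hQ0 : Q ≠ 0 := fun h => by simp [h] at hQ
  have hβ : 0 < (Q / (a : ℂ)).re := by
    rw [div_ofReal_re]
    exact div_pos hQ ha
  have hpt : ∀ z : ℂ,
      cexp (-((a : ℂ) * P + z * W₂ + conj z * W₁ + ((normSq z / a : ℝ) : ℂ) * Q)) * (a : ℂ) ^ (s - 2) *
          ((1 / Q) ^ (s - 1) * Complex.Gamma (s - 1)) =
        (cexp (-((a : ℂ) * P)) * (a : ℂ) ^ (s - 2) * ((1 / Q) ^ (s - 1) * Complex.Gamma (s - 1))) *
          cexp (-(Q / (a : ℂ) * (normSq z : ℂ) + (z * W₂ + conj z * W₁))) := by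
    intro z
    have hexp : cexp (-((a : ℂ) * P + z * W₂ + conj z * W₁ + ((normSq z / a : ℝ) : ℂ) * Q)) =
        cexp (-((a : ℂ) * P)) * cexp (-(Q / (a : ℂ) * (normSq z : ℂ) + (z * W₂ + conj z * W₁))) := by
      rw [← Complex.exp_add]
      congr 1
      push_cast
      field_simp
      ring
    rw [hexp]
    ring
  simp_rw [hpt]
  rw [integral_const_mul, integral_cexp_neg_mul_normSq_sub_linear hβ W₁ W₂]
  have hpow : (a : ℂ) ^ (s - 1) = (a : ℂ) ^ (s - 2) * a := by
    rw [show s - 1 = s - 2 + 1 by ring, cpow_add _ _ ha0, cpow_one]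
  have hexp2 : cexp (-((a : ℂ) * P)) * cexp (W₁ * W₂ / (Q / (a : ℂ))) = cexp (-((P - W₁ * W₂ / Q) * a)) := by
    rw [← Complex.exp_add]
    congr 1
    field_simp
    ring
  rw [hpow, ← hexp2]
  generalize (a : ℂ) ^ (s - 2) = A
  generalize (1 / Q) ^ (s - 1) = B
  field_simp

/-- The closed form of the `z`-fibre is nonzero. -/
theorem tube_fibre_z_ne_zero (hQ : 0 < Q.re) {s : ℂ} (hs : 1 < s.re) {a : ℝ} (ha : 0 < a) :
    (Real.pi : ℂ) * Complex.Gamma (s - 1) * (1 / Q) ^ (s - 1) * (1 / Q) *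
        ((a : ℂ) ^ (s - 1) * cexp (-((P - W₁ * W₂ / Q) * a))) ≠ 0 := by
  have hQ0 : Q ≠ 0 := fun h => by simp [h] at hQ
  have hπ : (Real.pi : ℂ) ≠ 0 := ofReal_ne_zero.mpr Real.pi_pos.ne'
  have h1 : (a : ℂ) ^ (s - 1) ≠ 0 := by
    rw [Ne, cpow_eq_zero_iff, not_and_or]
    exact Or.inl (ofReal_ne_zero.mpr ha.ne')
  have h2 : (1 / Q) ^ (s - 1) ≠ 0 := by
    rw [Ne, cpow_eq_zero_iff, not_and_or]
    exact Or.inl (one_div_ne_zero hQ0)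
  have h3 : Complex.Gamma (s - 1) ≠ 0 :=
    Complex.Gamma_ne_zero_of_re_pos (by simp only [sub_re, one_re]; linarith)
  have h4 : (1 / Q) ≠ 0 := one_div_ne_zero hQ0
  exact mul_ne_zero (mul_ne_zero (mul_ne_zero (mul_ne_zero hπ h3) h2) h4) (mul_ne_zero h1 (Complex.exp_ne_zero _))

/-! ### Level 3: the fibre in `a` (complex-`r` Gamma integral, `re (P − W₁W₂/Q) > 0`) and the branch -/

/-- Integrating the closed form of the `z`-fibre over `a > 0`: `Γ₂(s) · (PQ − W₁W₂)^{−s}` (principal power), provided `re Q > 0` and the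
Schur complement `P − W₁W₂/Q` has positive real part. -/
theorem integral_tube_fibre_a (hQ : 0 < Q.re) (hS : 0 < (P - W₁ * W₂ / Q).re) {s : ℂ} (hs : 1 < s.re) :
    ∫ a in Ioi (0 : ℝ), (Real.pi : ℂ) * Complex.Gamma (s - 1) * (1 / Q) ^ (s - 1) * (1 / Q) *
        ((a : ℂ) ^ (s - 1) * cexp (-((P - W₁ * W₂ / Q) * a))) =
      hermTwoGamma s * (P * Q - W₁ * W₂) ^ (-s) := by
  have hQ0 : Q ≠ 0 := fun h => by simp [h] at hQ
  rw [integral_const_mul, Literature.NumberTheory.LFunctions.AFE.integral_cpow_mul_exp_neg_mul_Ioi_complex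
    (by linarith : 0 < s.re) hS, hermTwoGamma_def]
  have h1 : (1 / Q) ^ (s - 1) * (1 / Q) = (1 / Q) ^ s := by
    conv_rhs => rw [show s = s - 1 + 1 by ring, cpow_add _ _ (one_div_ne_zero hQ0), cpow_one]
  have h2 : (1 / Q) ^ s * (1 / (P - W₁ * W₂ / Q)) ^ s = (P * Q - W₁ * W₂) ^ (-s) := by
    rw [Literature.Analysis.SpecialFunctions.one_div_cpow_eq_cpow_neg hQ,
      Literature.Analysis.SpecialFunctions.one_div_cpow_eq_cpow_neg hS,
      ← Literature.Dynamics.TransferOperators.mul_cpow_of_re_pos hQ hS]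
    congr 1
    field_simp
  calc (Real.pi : ℂ) * Complex.Gamma (s - 1) * (1 / Q) ^ (s - 1) * (1 / Q) *
        ((1 / (P - W₁ * W₂ / Q)) ^ s * Complex.Gamma s)
      = (Real.pi : ℂ) * Complex.Gamma s * Complex.Gamma (s - 1) *
          (((1 / Q) ^ (s - 1) * (1 / Q)) * (1 / (P - W₁ * W₂ / Q)) ^ s) := by ring
    _ = (Real.pi : ℂ) * Complex.Gamma s * Complex.Gamma (s - 1) * (P * Q - W₁ * W₂) ^ (-s) := by rw [h1, h2]


end Coordinates

end Summit.HodgeConjecture.HodgeConjecture.Cruxes.HLiu418.K2LiuHermTwoSiegelGindikinTubeFibres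

end
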